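import Literature.Topology.FourManifolds.SweepCapping
import Mathlib.Analysis.Calculus.BumpFunction.FiniteDimension
import HarnessLib

/-!
# Gluing tools for the sweep function of the capped-ball step

Topic `Literature/Topology/FourManifolds`; fact seat of Alexander's theorem
(`provefact-Literature.Topology.FourManifolds.SphereEmbedding.schoenflies_exists_ball`, Schultens
(2014), Thm. 3.2.5).  **Everything in this file is proved; no definitions, no named facts.**

Two elementary smooth-gluing lemmas used to build the global sweep function of the absorption
step (Schultens (2014), Lemma 3.2.3) from local pieces:

* `SweepGlue.exists_contDiff_eqOn_of_compact` — functions `g₁`, `g₂` smooth on open sets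
  `Ω₁`, `Ω₂` and equal on `Ω₁ ∩ Ω₂` glue, near any compact `K ⊆ Ω₁ ∪ Ω₂`, to a globally smooth
  function: there are a smooth `w` and an open `N ⊇ K` with `w = g₁` on `N ∩ Ω₁` and `w = g₂`
  on `N ∩ Ω₂` (smooth Urysohn cutoff supported in `Ω₁ ∪ Ω₂`);
* `SweepGlue.exists_contDiff_eventuallyEq` — a function smooth on an open set agrees near any
  of its points with a globally smooth function (bump function).

## References
* M. W. Hirsch, *Differential Topology*, Springer GTM 33 (1976), §2.2 (smooth partitions of
  unity, Urysohn).
* J. Schultens, *Introduction to 3-Manifolds*, GSM 151, AMS (2014), Lemma 3.2.3.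
-/

noncomputable section

open Set Metric Filter Topology Function
open scoped ContDiff

namespace Literature.Topology.FourManifolds.SweepGlue

variable {E : Type*} [NormedAddCommGroup E] [NormedSpace ℝ E] [FiniteDimensional ℝ E]

/-- **Smooth gluing near a compact set.**  Let `g₁`, `g₂` be `C^∞` on the open sets `Ω₁`, `Ω₂`
and agree on `Ω₁ ∩ Ω₂`, and let `K ⊆ Ω₁ ∪ Ω₂` be compact.  Then there are a `C^∞` function
`w : E → ℝ` and an open set `N` with `K ⊆ N ⊆ Ω₁ ∪ Ω₂`, `w = g₁` on `N ∩ Ω₁` and `w = g₂` on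
`N ∩ Ω₂`. [folklore] -/
theorem exists_contDiff_eqOn_of_compact {g₁ g₂ : E → ℝ} {Ω₁ Ω₂ K : Set E} (hΩ₁ : IsOpen Ω₁)
    (hΩ₂ : IsOpen Ω₂) (hg₁ : ContDiffOn ℝ ∞ g₁ Ω₁) (hg₂ : ContDiffOn ℝ ∞ g₂ Ω₂)
    (hagree : ∀ x ∈ Ω₁ ∩ Ω₂, g₁ x = g₂ x) (hK : IsCompact K) (hKΩ : K ⊆ Ω₁ ∪ Ω₂) (W₀ : ℝ) :
    ∃ (w : E → ℝ) (N : Set E), ContDiff ℝ ∞ w ∧ IsOpen N ∧ K ⊆ N ∧ N ⊆ Ω₁ ∪ Ω₂ ∧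
      (∀ x ∈ N ∩ Ω₁, w x = g₁ x) ∧ (∀ x ∈ N ∩ Ω₂, w x = g₂ x) := by
  classical
  set Ω := Ω₁ ∪ Ω₂ with hΩ
  have hΩo : IsOpen Ω := hΩ₁.union hΩ₂
  -- the piecewise function `g`, smooth on `Ω`
  set g : E → ℝ := fun x => if x ∈ Ω₁ then g₁ x else g₂ x with hg
  have hgΩ₁ : ∀ x ∈ Ω₁, g x = g₁ x := fun x hx => by simp only [hg, if_pos hx]
  have hgΩ₂ : ∀ x ∈ Ω₂, g x = g₂ x := fun x hx => by
    by_cases h1 : x ∈ Ω₁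
    · simp only [hg, if_pos h1]; exact hagree x ⟨h1, hx⟩
    · simp only [hg, if_neg h1]
  have hgs : ContDiffOn ℝ ∞ g Ω := by
    intro x hx
    rcases hx with hx | hx
    · have h : g =ᶠ[𝓝 x] g₁ := by
        filter_upwards [hΩ₁.mem_nhds hx] with y hy using hgΩ₁ y hy
      exact ((hg₁.contDiffAt (hΩ₁.mem_nhds hx)).congr_of_eventuallyEq h).contDiffWithinAt
    · have h : g =ᶠ[𝓝 x] g₂ := by
        filter_upwards [hΩ₂.mem_nhds hx] with y hy using hgΩ₂ y hy
      exact ((hg₂.contDiffAt (hΩ₂.mem_nhds hx)).congr_of_eventuallyEq h).contDiffWithinAt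
  -- a cutoff `ζ = 1` near `K`, supported inside `Ω`
  obtain ⟨ε, hε, hεΩ⟩ := hK.exists_cthickening_subset_open hΩo hKΩ
  have hε2 : 0 < ε / 2 := by linarith
  have hdisj : Disjoint (thickening (3 * ε / 4) K)ᶜ (cthickening (ε / 2) K) := by
    rw [disjoint_compl_left_iff_subset]
    exact cthickening_subset_thickening' (by linarith) (by linarith) K
  obtain ⟨ζ, hζs, hζ0, hζ1, hζ01⟩ := SweepCapping.exists_contDiff_zero_one
    (isOpen_thickening.isClosed_compl) (isClosed_cthickening) hdisj
  have hζsupp : tsupport ζ ⊆ Ω := by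
    have h1 : Function.support ζ ⊆ thickening (3 * ε / 4) K := by
      intro x hx
      by_contra h
      exact hx (hζ0 x h)
    calc tsupport ζ = closure (Function.support ζ) := rfl
      _ ⊆ closure (thickening (3 * ε / 4) K) := closure_mono h1
      _ ⊆ cthickening (3 * ε / 4) K := closure_thickening_subset_cthickening _ _
      _ ⊆ cthickening ε K := cthickening_mono (by linarith) K
      _ ⊆ Ω := hεΩ
  -- the glued function
  set w : E → ℝ := fun x => ζ x * g x + (1 - ζ x) * W₀ with hw
  have hws : ContDiff ℝ ∞ w := by
    rw [contDiff_iff_contDiffAt]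
    intro x
    by_cases hx : x ∈ Ω
    · have hgx : ContDiffAt ℝ ∞ g x := hgs.contDiffAt (hΩo.mem_nhds hx)
      exact (hζs.contDiffAt.mul hgx).add ((contDiffAt_const.sub hζs.contDiffAt).mul contDiffAt_const)
    · -- off `tsupport ζ`: `w = W₀` near `x`
      have hxs : x ∉ tsupport ζ := fun h => hx (hζsupp h)
      have hev : ζ =ᶠ[𝓝 x] 0 := by
        have : x ∈ (tsupport ζ)ᶜ := hxs
        filter_upwards [(isClosed_tsupport ζ).isOpen_compl.mem_nhds this] with y hy
        exact image_eq_zero_of_notMem_tsupport hy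
      have hev' : w =ᶠ[𝓝 x] fun _ => W₀ := by
        filter_upwards [hev] with y hy
        simp only [hw, hy, Pi.zero_apply, zero_mul, zero_add, sub_zero, one_mul]
      exact contDiffAt_const.congr_of_eventuallyEq hev'
  refine ⟨w, thickening (ε / 2) K ∩ Ω, hws, isOpen_thickening.inter hΩo,
    fun x hx => ⟨self_subset_thickening hε2 K hx, hKΩ hx⟩, inter_subset_right, ?_, ?_⟩
  · rintro x ⟨⟨hxt, -⟩, hx1⟩
    have hζx : ζ x = 1 := hζ1 x (thickening_subset_cthickening _ _ hxt)
    simp only [hw, hζx, one_mul, sub_self, zero_mul, add_zero]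
    exact hgΩ₁ x hx1
  · rintro x ⟨⟨hxt, -⟩, hx2⟩
    have hζx : ζ x = 1 := hζ1 x (thickening_subset_cthickening _ _ hxt)
    simp only [hw, hζx, one_mul, sub_self, zero_mul, add_zero]
    exact hgΩ₂ x hx2

omit [FiniteDimensional ℝ E] in
/-- **Localisation**: a function `C^∞` on an open set agrees near any point of the set with a
globally `C^∞` function. [folklore] -/
theorem exists_contDiff_eventuallyEq [FiniteDimensional ℝ E] {f : E → ℝ} {U : Set E}
    (hU : IsOpen U) (hf : ContDiffOn ℝ ∞ f U) {x : E} (hx : x ∈ U) :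
    ∃ g : E → ℝ, ContDiff ℝ ∞ g ∧ g =ᶠ[𝓝 x] f := by
  obtain ⟨r, hr, hrU⟩ := Metric.isOpen_iff.1 hU x hx
  -- a bump `= 1` on `closedBall x (r/4)`, supported in `closedBall x (r/2) ⊆ U`
  let b : ContDiffBump x := ⟨r / 4, r / 2, by linarith, by linarith⟩
  set g : E → ℝ := fun y => b y * f y with hg
  have hsupp : tsupport (b : E → ℝ) ⊆ U := by
    rw [b.tsupport_eq]
    exact (closedBall_subset_ball (by show r / 2 < r; linarith)).trans hrU
  refine ⟨g, ?_, ?_⟩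
  · rw [contDiff_iff_contDiffAt]
    intro y
    by_cases hy : y ∈ U
    · exact b.contDiff.contDiffAt.mul (hf.contDiffAt (hU.mem_nhds hy))
    · have hys : y ∉ tsupport (b : E → ℝ) := fun h => hy (hsupp h)
      have hev : (b : E → ℝ) =ᶠ[𝓝 y] 0 := by
        filter_upwards [(isClosed_tsupport (b : E → ℝ)).isOpen_compl.mem_nhds hys] with z hz
        exact image_eq_zero_of_notMem_tsupport hz
      have hev' : g =ᶠ[𝓝 y] fun _ => 0 := by
        filter_upwards [hev] with z hz
        simp only [hg, hz, Pi.zero_apply, zero_mul]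
      exact contDiffAt_const.congr_of_eventuallyEq hev'
  · have hball : ball x (r / 4) ∈ 𝓝 x := ball_mem_nhds x (by linarith)
    filter_upwards [hball] with y hy
    have : b y = 1 := b.one_of_mem_closedBall (ball_subset_closedBall hy)
    simp only [hg, this, one_mul]

end Literature.Topology.FourManifolds.SweepGlue
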